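import Summits.BirchSwinnertonDyer.BirchSwinnertonDyer.Theorems.SignedLowerHalvesSprungLowerDivisibilityAtThreeSlopeSeparationResidualDoor
import Summits.BirchSwinnertonDyer.Rank1Residual.Supersingular.MazurTateReduction
import Summits.BirchSwinnertonDyer.Rank1Residual.Supersingular.MazurTateLambdaReading
import HarnessLib

/-!
# Crux `SprungLowerDivisibilityAtThree` (item stmt-BirchSwinnertonDyer-19875), line `chromatic-common-zeros`:
# the TURNKEY form (R6-MT) of the first-or-second-order door (R6) — every input read off EXACT data:
# `[0]⁺_f`, and two Mazur–Tate layers (their `(μ, λ)` and ONE coefficient residue each)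

Cell `bsd-ssimc` (host) / lead `cruxlead-stmt-BirchSwinnertonDyer-19875`; width seat `-w3` (gen 3);
`--supports` 19875 `--as helper`; THEOREMS ONLY; PER PAIR; closes no item; BSD / K1 / leaf X8 are NOT proved
by anything here.

Door (R6) `sprungSharpFlatLowerDivisibility_of_lam_ne_or_residual` (p627908) closes K1 for BOTH colours of an
X8 pair from `‖[0]⁺_f‖₃ = 1/3`, `μ(L♯) = μ(L♭) = 0` and `λ♯ ≠ λ♭ ∨ ‖c♯·L♭_{λ♭} − c♭·L♯_{λ♯}‖ = 1`. The
present file reads ALL of these off the Mazur–Tate elements, as the x8 engines compute them: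

* §1 **the leading residue of `L^•` is a Mazur–Tate coefficient residue.** At an odd layer `n` with
  integral model `Θ` of `θ_n` (`ι Θ = θ_n`), `Θ ≠ 0`, `μ(Θ) = 0`, `λ(Θ) = deg ω⁺_n + l`: `μ(L♯) = 0`,
  `λ(L♯) = l` (the tree's `lam_sharp_eq_of_mazurTate'`) AND
  **`res(L♯_l) = −(−1)^{⌊n/2⌋} · res(Θ_{deg ω⁺_n + l})`** (`residue_coeff_sharp_eq_of_mazurTate`): in
  `𝔽_p⟦T⟧`, `Θ̄ = T^{pⁿ} Q̄ − (−1)^{⌊n/2⌋} T^{deg ω⁺_n} L̄♯` (`red_toIwasawa_sharpPoly_of_odd`,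
  `red_toIwasawa_flatPoly_of_odd`, `red_toIwasawa_cyclotomicOmega`), and `deg ω⁺_n + l = λ(Θ) < pⁿ`.
  Even layers / `♭` likewise (`residue_coeff_flat_eq_of_mazurTate`).
* §2 **(R6-MT) `sprungSharpFlatLowerDivisibility_of_mazurTate_lam_ne_or_residue`** — X8 pair; per
  newform: `‖[0]⁺_f‖₃ = 1/3`, one odd layer `(n♯, Θ♯, l♯)` and one even layer `(n♭, Θ♭, l♭)` as above,
  and `l♯ ≠ l♭` OR the residue inequality
  `res(c♯)·(−(−1)^{⌊n♭/2⌋} res(Θ♭_{deg ω⁻_{n♭} + l♭})) ≠ res(c♭)·(−(−1)^{⌊n♯/2⌋} res(Θ♯_{deg ω⁺_{n♯} + l♯}))`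
  in `𝔽₃` ⟹ `Theorems.SprungSharpFlatLowerDivisibility W 3 •` for EVERY colour. CONDITIONAL on `h714`,
  `h3`, `hJ` (as (R2)/(R6)). The data are EXACT: `[0]⁺_f ∈ ℚ`, `θ_{n♯}, θ_{n♭} ∈ ℚ[T]` (their `(μ, λ)`
  via `Iwasawa/LambdaInvariantValuationResultant.lean`, and one coefficient residue mod `3` each).

Census reading (x8 R5 n5): this is the single schema behind the 20 (R4) cells and the 16 rank-0 equal-λ
cells (12 × λ = 2, 4 × λ = 4) — 36 rank-0 cells decided by exact Mazur–Tate data whenever `l♯ ≠ l♭` or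
the two residues differ. Nothing here is asserted about any particular curve.

References: [Pollack2003] Prop. 6.9–6.10, §6.5; [Sprung2017] §3, Cor. 3.6, Thm. 1.12, Cor. 4.4, 4.11;
[Sprung2012] Thm. 7.14 (3), Prop. 7.19; [Koblitz1984] Ch. IV §4; [Washington1997] §7.1–7.2, §13.2; tree:
`Supersingular/MazurTateReduction`, `…/MazurTateLambdaReading`, `…/MazurTateCertificates`,
`…SlopeSeparationResidual{,Door}`.
-/

set_option autoImplicit false
-- justification: the mandated namespace `Summit.BirchSwinnertonDyer.BirchSwinnertonDyer.Theorems`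
-- (single-conjunct summit, Sub = Summit) repeats a segment by design (D-0017).
set_option linter.dupNamespace false

noncomputable section

open scoped Classical NumberField MatrixGroups ModularForm

open NumberField IsDedekindDomain CongruenceSubgroup WeierstrassCurve Field
  Literature.NumberTheory.EllipticCurves Literature.NumberTheory.EllipticCurves.ModularForms
  Literature.NumberTheory.EllipticCurves.ZpExtension Literature.NumberTheory.EllipticCurves.Sprung2017
  Literature.NumberTheory.EllipticCurves.Sprung2012 Literature.NumberTheory.EllipticCurves.Rank1Residual
  Literature.NumberTheory.EllipticCurves.IwasawaAlgebra
  Summit.BirchSwinnertonDyer.BirchSwinnertonDyer.Theorems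
  Summit.BirchSwinnertonDyer.Rank1Residual.Supersingular
  Summit.BirchSwinnertonDyer.Rank1Residual.X1.MuLambda
  Summit.BirchSwinnertonDyer.Rank1Residual.Iwasawa
  Summit.BirchSwinnertonDyer.BirchSwinnertonDyer.Theorems.ChromaticSlopeSeparation

namespace Summit.BirchSwinnertonDyer.BirchSwinnertonDyer.Theorems.ChromaticCommonZeros

/-! ## §1. The leading residue of `L^•` from one Mazur–Tate layer -/

section Residues

variable {W : WeierstrassCurve ℚ} [W.IsElliptic] [W.IsGloballyMinimal] {p : ℕ} [hp : Fact p.Prime]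
  {N : ℕ} [NeZero N] {f : CuspForm (Gamma0 N) 2}

/-- Coefficient extraction: in `k⟦T⟧`, if `Θ̄ = T^M·Q̄ + (C c · T^d)·Ā` and `d + l < M` then
`Θ̄_{d+l} = c · Ā_l`. [folklore] -/
theorem coeff_eq_of_eq_X_pow_mul_add {k : Type*} [Field k] {Θ Q A : PowerSeries k} {c : k} {M d l : ℕ}
    (hΘ : Θ = PowerSeries.X ^ M * Q + PowerSeries.C c * PowerSeries.X ^ d * A) (hlt : d + l < M) :
    PowerSeries.coeff (d + l) Θ = c * PowerSeries.coeff l A := by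
  rw [hΘ, map_add, PowerSeries.coeff_X_pow_mul', if_neg (by omega), zero_add, mul_assoc,
    PowerSeries.coeff_C_mul, add_comm d l, PowerSeries.coeff_X_pow_mul]

/-- **The leading residue of `L♯` from an ODD Mazur–Tate layer.** `p ≠ 2`, `f` the newform of `W`, good
supersingular reduction (`p ∣ a_p`), `(L♯, L♭)` a Sprung pair; `n` odd, `Θ ∈ Λ` with `ι Θ = θ_n`, `Θ ≠ 0`,
`μ(Θ) = 0`, `λ(Θ) = deg ω⁺_n + l`. Then `μ(L♯) = 0`, `λ(L♯) = l` and
**`res(L♯_l) = −(−1)^{⌊n/2⌋} · res(Θ_{deg ω⁺_n + l})`** in `𝔽_p`.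
[cite: Pollack2003, Prop. 6.9 and Prop. 6.10] [cite: Sprung2017, §3.1, Cor. 3.6 and Cor. 4.4] -/
theorem residue_coeff_sharp_eq_of_mazurTate (hp2 : p ≠ 2) (hf : IsNewformOf W f)
    (hgood : W.HasGoodReductionAtPrime p) (hap : (p : ℤ) ∣ W.frobeniusTrace p)
    {Lsharp Lflat : IwasawaAlgebra p} (hSP : IsSprungPair f p (W.frobeniusTrace p) Lsharp Lflat)
    {n : ℕ} (hn : Odd n) {Θ : IwasawaAlgebra p}
    (hΘ : iwasawaToPowerSeries p Θ =
      ((mazurTateElement f p n).map (algebraMap ℚ ℚ_[p]) : PowerSeries ℚ_[p]))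
    (hΘ0 : Θ ≠ 0) (hμ : mu Θ = 0) {l : ℕ}
    (hlam : lam Θ = (cyclotomicOmegaPlus p n).natDegree + l) :
    mu Lsharp = 0 ∧ lam Lsharp = l ∧
      IsLocalRing.residue ℤ_[p] (PowerSeries.coeff l Lsharp) =
        -(-1) ^ (n / 2) *
          IsLocalRing.residue ℤ_[p] (PowerSeries.coeff ((cyclotomicOmegaPlus p n).natDegree + l) Θ) := by
  obtain ⟨hμs, hls⟩ := lam_sharp_eq_of_mazurTate' hp2 hf hgood hap hSP hn hΘ hΘ0 hμ hlam
  refine ⟨hμs, hls, ?_⟩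
  -- `Θ = ω_n Q − (u_n L♯ + v_n L♭)` in `Λ`
  obtain ⟨Q, hQ⟩ := exists_integral_mazurTate_of_isSprungPair hp2 hf hgood hap hSP n
  have hΘeq : Θ = toIwasawa p (cyclotomicOmega p n) * Q -
      (toIwasawa p (sharpPoly (W.frobeniusTrace p) p n) * Lsharp +
        toIwasawa p (flatPoly (W.frobeniusTrace p) p n) * Lflat) :=
    iwasawaToPowerSeries_injective p (by rw [hΘ, hQ])
  -- reduce mod `p`: `Θ̄ = T^{pⁿ} Q̄ + (C(−(−1)^{n/2}) T^{deg ω⁺}) L̄♯`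
  have hred : red Θ = PowerSeries.X ^ (p ^ n) * red Q +
      PowerSeries.C (-(-1 : IsLocalRing.ResidueField ℤ_[p]) ^ (n / 2)) *
        PowerSeries.X ^ (cyclotomicOmegaPlus p n).natDegree * red Lsharp := by
    rw [hΘeq, red, map_sub, map_mul, map_add, map_mul, map_mul]
    change red (toIwasawa p (cyclotomicOmega p n)) * red Q -
      (red (toIwasawa p (sharpPoly (W.frobeniusTrace p) p n)) * red Lsharp +
        red (toIwasawa p (flatPoly (W.frobeniusTrace p) p n)) * red Lflat) = _
    rw [red_toIwasawa_cyclotomicOmega, red_toIwasawa_sharpPoly_of_odd hap hn,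
      red_toIwasawa_flatPoly_of_odd hap hn, zero_mul, add_zero, map_neg, map_pow, map_neg, map_one]
    ring
  have hlt : (cyclotomicOmegaPlus p n).natDegree + l < p ^ n := by
    rw [← hlam]; exact lam_lt_of_mazurTate hΘ hΘ0 hμ
  have hcoeff := coeff_eq_of_eq_X_pow_mul_add hred hlt
  rw [PowerSeries.coeff_map, PowerSeries.coeff_map] at hcoeff
  rw [hcoeff, ← mul_assoc]
  have hsq : (-(-1 : IsLocalRing.ResidueField ℤ_[p]) ^ (n / 2)) * (-(-1) ^ (n / 2)) = 1 := by
    rw [neg_mul_neg, ← pow_add, ← two_mul, pow_mul, neg_one_sq, one_pow]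
  rw [hsq, one_mul]

/-- **The leading residue of `L♭` from an EVEN Mazur–Tate layer**: `n` even, `λ(Θ) = deg ω⁻_n + l` ⟹
`μ(L♭) = 0`, `λ(L♭) = l`, `res(L♭_l) = −(−1)^{⌊n/2⌋} · res(Θ_{deg ω⁻_n + l})`.
[cite: Pollack2003, Prop. 6.9 and Prop. 6.10] [cite: Sprung2017, §3.1, Cor. 3.6 and Cor. 4.4] -/
theorem residue_coeff_flat_eq_of_mazurTate (hp2 : p ≠ 2) (hf : IsNewformOf W f)
    (hgood : W.HasGoodReductionAtPrime p) (hap : (p : ℤ) ∣ W.frobeniusTrace p)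
    {Lsharp Lflat : IwasawaAlgebra p} (hSP : IsSprungPair f p (W.frobeniusTrace p) Lsharp Lflat)
    {n : ℕ} (hn : Even n) {Θ : IwasawaAlgebra p}
    (hΘ : iwasawaToPowerSeries p Θ =
      ((mazurTateElement f p n).map (algebraMap ℚ ℚ_[p]) : PowerSeries ℚ_[p]))
    (hΘ0 : Θ ≠ 0) (hμ : mu Θ = 0) {l : ℕ}
    (hlam : lam Θ = (cyclotomicOmegaMinus p n).natDegree + l) :
    mu Lflat = 0 ∧ lam Lflat = l ∧
      IsLocalRing.residue ℤ_[p] (PowerSeries.coeff l Lflat) =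
        -(-1) ^ (n / 2) *
          IsLocalRing.residue ℤ_[p] (PowerSeries.coeff ((cyclotomicOmegaMinus p n).natDegree + l) Θ) := by
  obtain ⟨hμf, hlf⟩ := lam_flat_eq_of_mazurTate' hp2 hf hgood hap hSP hn hΘ hΘ0 hμ hlam
  refine ⟨hμf, hlf, ?_⟩
  obtain ⟨Q, hQ⟩ := exists_integral_mazurTate_of_isSprungPair hp2 hf hgood hap hSP n
  have hΘeq : Θ = toIwasawa p (cyclotomicOmega p n) * Q -
      (toIwasawa p (sharpPoly (W.frobeniusTrace p) p n) * Lsharp +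
        toIwasawa p (flatPoly (W.frobeniusTrace p) p n) * Lflat) :=
    iwasawaToPowerSeries_injective p (by rw [hΘ, hQ])
  have hred : red Θ = PowerSeries.X ^ (p ^ n) * red Q +
      PowerSeries.C (-(-1 : IsLocalRing.ResidueField ℤ_[p]) ^ (n / 2)) *
        PowerSeries.X ^ (cyclotomicOmegaMinus p n).natDegree * red Lflat := by
    rw [hΘeq, red, map_sub, map_mul, map_add, map_mul, map_mul]
    change red (toIwasawa p (cyclotomicOmega p n)) * red Q -
      (red (toIwasawa p (sharpPoly (W.frobeniusTrace p) p n)) * red Lsharp +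
        red (toIwasawa p (flatPoly (W.frobeniusTrace p) p n)) * red Lflat) = _
    rw [red_toIwasawa_cyclotomicOmega, red_toIwasawa_sharpPoly_of_even hap hn,
      red_toIwasawa_flatPoly_of_even hap hn, zero_mul, zero_add, map_neg, map_pow, map_neg, map_one]
    ring
  have hlt : (cyclotomicOmegaMinus p n).natDegree + l < p ^ n := by
    rw [← hlam]; exact lam_lt_of_mazurTate hΘ hΘ0 hμ
  have hcoeff := coeff_eq_of_eq_X_pow_mul_add hred hlt
  rw [PowerSeries.coeff_map, PowerSeries.coeff_map] at hcoeff
  rw [hcoeff, ← mul_assoc]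
  have hsq : (-(-1 : IsLocalRing.ResidueField ℤ_[p]) ^ (n / 2)) * (-(-1) ^ (n / 2)) = 1 := by
    rw [neg_mul_neg, ← pow_add, ← two_mul, pow_mul, neg_one_sq, one_pow]
  rw [hsq, one_mul]

/-- In `ℤ_p`: `‖x‖ = 1 ↔ res(x) ≠ 0`. [folklore] -/
theorem norm_eq_one_iff_residue_ne_zero (x : ℤ_[p]) :
    ‖x‖ = 1 ↔ IsLocalRing.residue ℤ_[p] x ≠ 0 := by
  rw [IsLocalRing.residue_ne_zero_iff_isUnit, PadicInt.isUnit_iff]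

end Residues

/-! ## §2. (R6-MT): the turnkey door -/

section R6MT

variable (W : WeierstrassCurve ℚ) [W.IsElliptic] [W.IsGloballyMinimal] (p : ℕ) [Fact p.Prime]

/-- **(R6-MT) K1 for BOTH colours from `[0]⁺_f` and two Mazur–Tate layers (invariants + one residue
each).** On an X8 pair, suppose that for (every) newform `f` of `W`: `‖[0]⁺_f‖₃ = 1/3`; an ODD layer
`n♯` with integral model `Θ♯` of `θ_{n♯}` (`ι Θ♯ = θ_{n♯}`, `Θ♯ ≠ 0`, `μ(Θ♯) = 0`,
`λ(Θ♯) = deg ω⁺_{n♯} + l♯`) and an EVEN layer `n♭` likewise with `l♭`; and EITHER `l♯ ≠ l♭` OR the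
residue inequality in `𝔽₃`
`res(c♯)·(−(−1)^{⌊n♭/2⌋}·res(Θ♭_{deg ω⁻_{n♭}+l♭})) ≠ res(c♭)·(−(−1)^{⌊n♯/2⌋}·res(Θ♯_{deg ω⁺_{n♯}+l♯}))`
(`c♯ = −a₃² + 2a₃ + 2`, `c♭ = 2 − a₃`). Then `Theorems.SprungSharpFlatLowerDivisibility W p •` holds for
EVERY colour `•`: by §1 every Sprung pair has `μ = 0`, `λ(L♯) = l♯`, `λ(L♭) = l♭` and leading residues equal
to the displayed Mazur–Tate residues, so the hypothesis of (R6) holds. CONDITIONAL on `h714`, `h3`, `hJ`.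
PER PAIR; image-free; ALL inputs are exact rational data. [cite: Pollack2003, Prop. 6.9 and Prop. 6.10]
[cite: Sprung2017, Thm. 1.12, Cor. 4.4 and Cor. 4.11] [cite: Sprung2012, Thm. 7.14 (3) (p. 1504), Prop. 7.19 (p. 1505)]
[cite: Koblitz1984, Ch. IV §4 (Newton polygon of a power series)] -/
theorem sprungSharpFlatLowerDivisibility_of_mazurTate_lam_ne_or_residue
    (h714 : thm714_sharpFlatSelmerDual_finite_torsion) (h3 : realPeriodRat_eq_unit_mul_plusPeriod_three)
    (hJ : thm714seq_sharpFlatColemanKato_zetaJoint) (hX : ClassX8 W p)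
    (hdata : ∀ {N : ℕ} [NeZero N] (f : CuspForm (Gamma0 N) 2), IsNewformOf W f →
      ‖((ratPlusSymbol f 0 : ℚ) : ℚ_[p])‖ = (p : ℝ)⁻¹ ∧
      ∃ (ns nf ls lf : ℕ) (Θs Θf : IwasawaAlgebra p), Odd ns ∧ Even nf ∧
        iwasawaToPowerSeries p Θs =
          ((mazurTateElement f p ns).map (algebraMap ℚ ℚ_[p]) : PowerSeries ℚ_[p]) ∧
        Θs ≠ 0 ∧ mu Θs = 0 ∧ lam Θs = (cyclotomicOmegaPlus p ns).natDegree + ls ∧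
        iwasawaToPowerSeries p Θf =
          ((mazurTateElement f p nf).map (algebraMap ℚ ℚ_[p]) : PowerSeries ℚ_[p]) ∧
        Θf ≠ 0 ∧ mu Θf = 0 ∧ lam Θf = (cyclotomicOmegaMinus p nf).natDegree + lf ∧
        (ls ≠ lf ∨
          IsLocalRing.residue ℤ_[p] ((chromaticConst p (W.frobeniusTrace p) Chroma.sharp : ℤ) : ℤ_[p]) *
              (-(-1) ^ (nf / 2) * IsLocalRing.residue ℤ_[p]
                (PowerSeries.coeff ((cyclotomicOmegaMinus p nf).natDegree + lf) Θf)) ≠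
            IsLocalRing.residue ℤ_[p] ((chromaticConst p (W.frobeniusTrace p) Chroma.flat : ℤ) : ℤ_[p]) *
              (-(-1) ^ (ns / 2) * IsLocalRing.residue ℤ_[p]
                (PowerSeries.coeff ((cyclotomicOmegaPlus p ns).natDegree + ls) Θs))))
    (col : Chroma) : SprungSharpFlatLowerDivisibility W p col := by
  refine sprungSharpFlatLowerDivisibility_of_lam_ne_or_residual W p h714 h3 hJ hX
    (fun f hf ↦ (hdata f hf).1) ?_ col
  intro N _ f hf Lsharp Lflat hSP
  obtain ⟨hp3, ⟨hgood, hap⟩, -⟩ := id hX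
  subst hp3
  have hp2 : (3 : ℕ) ≠ 2 := by decide
  obtain ⟨-, ns, nf, ls, lf, Θs, Θf, hns, hnf, hΘs, hΘs0, hμΘs, hlamΘs, hΘf, hΘf0, hμΘf, hlamΘf, hsep⟩ :=
    hdata f hf
  obtain ⟨hμs, hls, hress⟩ :=
    residue_coeff_sharp_eq_of_mazurTate hp2 hf hgood hap hSP hns hΘs hΘs0 hμΘs hlamΘs
  obtain ⟨hμf, hlf, hresf⟩ :=
    residue_coeff_flat_eq_of_mazurTate hp2 hf hgood hap hSP hnf hΘf hΘf0 hμΘf hlamΘf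
  refine ⟨hμs, hμf, ?_⟩
  rcases hsep with hne | hres
  · left; rw [hls, hlf]; exact hne
  · right
    rw [norm_eq_one_iff_residue_ne_zero, map_sub, map_mul, map_mul, hls, hlf, hress, hresf]
    exact sub_ne_zero.mpr hres

end R6MT

end Summit.BirchSwinnertonDyer.BirchSwinnertonDyer.Theorems.ChromaticCommonZeros

end
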